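import Summits.CriticalPhenomena.SAWScalingLimit.Theses.SAWDefectDecoherence
import Summits.CriticalPhenomena.SAWScalingLimit.Theorems.SAWDefectDecoherenceBoundaryWindingRigidity
import Summits.CriticalPhenomena.SAWScalingLimit.Theorems.SAWDefectDecoherenceDecoherenceSynthesis
import Summits.CriticalPhenomena.SAWScalingLimit.Theorems.SAWDefectDecoherenceConjugateClassNegligibleSums
import HarnessLib

/-!
# The pinned normaliser of the local `L¹` law does not vanish (crux `BoundaryClosureR`,
stmt-CriticalPhenomena-14004, lines `pick-half-plane` / `dressed-arrival-cauchy-transform`,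
stub `stub_localL1Bound`)

The registered stub `LocalL1Bound` of the two lines asks, for the `σ = 5/8` critical observable
`F_δ = F(e δ, ·, x_c, 5/8)` of an admissible family `Λ δ` rooted at a pinned flat root `e δ` and
normalised at the pinned normaliser `b δ`, that on every compact `K ⊂ Ω`
`δ² Σ_{z ∈ Ω_δ, δ·mid z ∈ K} ‖F_δ(z)‖ ≤ C_K ‖F_δ(b δ)‖` eventually as `δ → 0+`.

This file records the EXACT (model-independent) part of the audit of that statement:

* `observable_eq_phase_mul_zero_spin_of_mem_boundary`: for a simply connected domain and two
  boundary mid-edges `a, b`, `F_{x,σ}(b) = e^{-iσ W} · F_{x,0}(b)` with `W` the common winding of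
  all walks `a → b` (winding rigidity = the route's proved support item `BoundaryWindingRigidity`,
  `boundaryWindingRigidity_proof`; an independent Literature proof is
  `HexMidEdgeSAW.winding_eq_of_mem_boundary` of `HexSAWPathRigidity.lean`; DCS 2012 §3); hence
  `‖F_{x,σ}(b)‖ = F_{x,0}(b) = Σ_{γ : a → b} x^{ℓ(γ)}` (`norm_observable_eq_mass_of_mem_boundary`)
  and `F_{x,σ}(b) ≠ 0` as soon as one walk `a → b` exists and `x > 0`
  (`observable_ne_zero_of_mem_boundary`) — UNCONDITIONALLY (the route's conditional form
  `DecoherenceSynthesis.norm_obs_eq_of_rigidity (hW : BoundaryWindingRigidity)` with `hW` discharged).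
* `eventually_normaliser_ne_zero`: in the frame of the stub (eventual simple connectivity and
  `b δ ∈ ∂Ω_δ` from `AdmissibleFamily`, eventual `e δ ∈ ∂Ω_δ` and `Nonempty (e δ → b δ)` from
  `PinnedFlatRoot`) the normaliser `F_δ(b δ)` is eventually non-zero and `‖F_δ(b δ)‖ = Z_δ(b δ)`:
  the right-hand side of `LocalL1Bound` is eventually positive, so the statement is not degenerate.
* `l1Functional_nonneg`, `l1Functional_le_massFunctional`, `l1Functional_le_of_mass_le`: the
  left-hand side (a genuine finite sum: the index set is a subset of the finite set of domain
  mid-edges, `PickHalfPlane.GateMass.finite_midEdgeWindow` / `MassRatio.Negative.hexDomainMidEdges_finite`)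
  is `≥ 0` and bounded by the same functional of the MASSES `Z_δ = F(e δ, ·, x_c, 0)`
  (`‖F_{5/8}‖ ≤ F_0` edge by edge, `ConjugateClassNegligibleSynthesis.norm_obs_le_norm_obs_zero`) —
  which is what the route's crux `MassRatio` controls, with the loss `δ^{-3/4}`; the stub itself asks
  for the loss-free bound, i.e. for the `δ^{25/48}` phase cancellation of the signal, and is OPEN (a
  bare statement about critical hexagonal self-avoiding walk, weaker than the locally uniform form of
  DCS Conjecture 2).

Nothing here is specific to `x_c` or `5/8` except where stated; no route item is assumed.
-/

noncomputable section

open scoped BigOperators Topology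
open Filter Set
open Literature.Probability.LatticeModels Literature.Probability.RandomPlanarGeometry
open Literature.Probability.RandomPlanarGeometry.SAW

namespace Summit.CriticalPhenomena.SAWScalingLimit.Theorems.PickHalfPlane.LocalL1

/-! ### Winding rigidity at a boundary normaliser: phase, modulus, non-vanishing -/

/-- **Phase factorisation at a boundary mid-edge.** In a simply connected domain, for boundary
mid-edges `a, b` and any walk `γ₀ : a → b`, `F_{x,σ}(b) = e^{-iσ W(γ₀)} · F_{x,0}(b)`: every walk
`a → b` has the winding of `γ₀` (DCS 2012, §3, rigidity of the boundary winding). -/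
theorem observable_eq_phase_mul_zero_spin_of_mem_boundary {Λ : Finset HexVertex}
    (hΛ : hexDomainSimplyConnected Λ) {a b : Sym2 HexVertex} (ha : a ∈ hexDomainBoundary Λ)
    (hb : b ∈ hexDomainBoundary Λ) (γ₀ : HexMidEdgeSAW Λ a b) (x σ : ℝ) :
    hexParafermionicObservable Λ a x σ b =
      Complex.exp (-Complex.I * σ * (γ₀.winding : ℝ)) * hexParafermionicObservable Λ a x 0 b := by
  rw [hexParafermionicObservable_def, hexParafermionicObservable_def, Finset.mul_sum]
  refine Finset.sum_congr rfl fun γ _ => ?_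
  rw [HexMidEdgeSAW.weight, HexMidEdgeSAW.weight_zero_spin,
    boundaryWindingRigidity_proof Λ hΛ a ha b hb γ γ₀]

/-- **Phase times mass.** Same, with the spin-`0` observable written as the real generating
function of the walks: `F_{x,σ}(b) = e^{-iσ W(γ₀)} · Σ_{γ : a → b} x^{ℓ(γ)}`. -/
theorem observable_eq_phase_mul_mass_of_mem_boundary {Λ : Finset HexVertex}
    (hΛ : hexDomainSimplyConnected Λ) {a b : Sym2 HexVertex} (ha : a ∈ hexDomainBoundary Λ)
    (hb : b ∈ hexDomainBoundary Λ) (γ₀ : HexMidEdgeSAW Λ a b) (x σ : ℝ) :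
    hexParafermionicObservable Λ a x σ b =
      Complex.exp (-Complex.I * σ * (γ₀.winding : ℝ)) *
        ((∑ γ : HexMidEdgeSAW Λ a b, x ^ γ.length : ℝ) : ℂ) := by
  rw [observable_eq_phase_mul_zero_spin_of_mem_boundary hΛ ha hb γ₀, hexParafermionicObservable_zero_spin]

/-- **Winding rigidity in modulus form (unconditional).** For a simply connected domain and
boundary mid-edges `a, b`: `‖F_{x,σ}(b)‖ = ‖F_{x,0}(b)‖` for every fugacity `x` and spin `σ`
(the route's `DecoherenceSynthesis.norm_obs_eq_of_rigidity` with its hypothesis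
`BoundaryWindingRigidity` discharged by `boundaryWindingRigidity_proof`). -/
theorem norm_observable_eq_norm_zero_spin_of_mem_boundary {Λ : Finset HexVertex}
    (hΛ : hexDomainSimplyConnected Λ) {a b : Sym2 HexVertex} (ha : a ∈ hexDomainBoundary Λ)
    (hb : b ∈ hexDomainBoundary Λ) (x σ : ℝ) :
    ‖hexParafermionicObservable Λ a x σ b‖ = ‖hexParafermionicObservable Λ a x 0 b‖ :=
  DecoherenceSynthesis.norm_obs_eq_of_rigidity boundaryWindingRigidity_proof hΛ ha hb x σ

/-- **`‖F_{x,σ}(b)‖ = Z(b)`**: for a simply connected domain, boundary mid-edges `a, b` and a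
fugacity `x ≥ 0`, the modulus of the observable at `b` is the two-point mass
`Σ_{γ : a → b} x^{ℓ(γ)}` (all walks carry one phase). -/
theorem norm_observable_eq_mass_of_mem_boundary {Λ : Finset HexVertex}
    (hΛ : hexDomainSimplyConnected Λ) {a b : Sym2 HexVertex} (ha : a ∈ hexDomainBoundary Λ)
    (hb : b ∈ hexDomainBoundary Λ) {x : ℝ} (hx : 0 ≤ x) (σ : ℝ) :
    ‖hexParafermionicObservable Λ a x σ b‖ = ∑ γ : HexMidEdgeSAW Λ a b, x ^ γ.length := by
  rw [norm_observable_eq_norm_zero_spin_of_mem_boundary hΛ ha hb x σ,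
    DecoherenceSynthesis.norm_obs_zero_spin Λ a b hx]

/-- **Positivity of the boundary normaliser.** If moreover a walk `a → b` exists and `x > 0`,
then `0 < ‖F_{x,σ}(b)‖`. -/
theorem norm_observable_pos_of_mem_boundary {Λ : Finset HexVertex}
    (hΛ : hexDomainSimplyConnected Λ) {a b : Sym2 HexVertex} (ha : a ∈ hexDomainBoundary Λ)
    (hb : b ∈ hexDomainBoundary Λ) (hne : Nonempty (HexMidEdgeSAW Λ a b)) {x : ℝ} (hx : 0 < x)
    (σ : ℝ) : 0 < ‖hexParafermionicObservable Λ a x σ b‖ := by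
  rw [norm_observable_eq_norm_zero_spin_of_mem_boundary hΛ ha hb x σ]
  exact DecoherenceSynthesis.norm_obs_zero_pos hne hx

/-- **Non-vanishing of the boundary normaliser**: `F_{x,σ}(b) ≠ 0` for a simply connected
domain, boundary `a, b` joined by at least one walk, and `x > 0`. -/
theorem observable_ne_zero_of_mem_boundary {Λ : Finset HexVertex}
    (hΛ : hexDomainSimplyConnected Λ) {a b : Sym2 HexVertex} (ha : a ∈ hexDomainBoundary Λ)
    (hb : b ∈ hexDomainBoundary Λ) (hne : Nonempty (HexMidEdgeSAW Λ a b)) {x : ℝ} (hx : 0 < x)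
    (σ : ℝ) : hexParafermionicObservable Λ a x σ b ≠ 0 :=
  norm_pos_iff.1 (norm_observable_pos_of_mem_boundary hΛ ha hb hne hx σ)

/-- **The normaliser in the frame of the stub.** Along any filter `l` on the meshes: if
eventually `Λ δ` is simply connected with `b δ ∈ ∂Ω_δ` (clauses of `AdmissibleFamily`) and
eventually `e δ ∈ ∂Ω_δ` with a walk `e δ → b δ` (clauses of `PinnedFlatRoot`), then eventually
the normaliser `F(e δ, b δ, x, σ)` is non-zero and its modulus is the mass `‖F(e δ, b δ, x, 0)‖`
(for every `x > 0`, in particular `x = x_c`, and every `σ`, in particular `5/8`). -/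
theorem eventually_normaliser_ne_zero {l : Filter ℝ} {Λ : ℝ → Finset HexVertex}
    {e b : ℝ → Sym2 HexVertex}
    (hb : ∀ᶠ δ in l, hexDomainSimplyConnected (Λ δ) ∧ b δ ∈ hexDomainBoundary (Λ δ))
    (he : ∀ᶠ δ in l, e δ ∈ hexDomainBoundary (Λ δ) ∧ Nonempty (HexMidEdgeSAW (Λ δ) (e δ) (b δ)))
    {x : ℝ} (hx : 0 < x) (σ : ℝ) :
    ∀ᶠ δ in l, hexParafermionicObservable (Λ δ) (e δ) x σ (b δ) ≠ 0 ∧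
      ‖hexParafermionicObservable (Λ δ) (e δ) x σ (b δ)‖ =
        ‖hexParafermionicObservable (Λ δ) (e δ) x 0 (b δ)‖ := by
  filter_upwards [hb, he] with δ hbδ heδ
  exact ⟨observable_ne_zero_of_mem_boundary hbδ.1 heδ.1 hbδ.2 heδ.2 hx σ,
    norm_observable_eq_norm_zero_spin_of_mem_boundary hbδ.1 heδ.1 hbδ.2 x σ⟩

/-- The same, fed VERBATIM with the eventual clauses of the two bundles of the stub
(`AdmissibleFamily`: simple connectivity ∧ `b δ ∈ ∂` ∧ connectedness ∧ inclusion ∧ the lattice pin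
at `pt 1`; `PinnedFlatRoot`: `e δ ∈ ∂` ∧ `Nonempty (e δ → b δ)` ∧ the lattice pin at the root), at
the critical fugacity and spin `5/8`: eventually `F_δ(b δ) ≠ 0` and `‖F_δ(b δ)‖ = Z_δ(b δ)`. -/
theorem eventually_normaliser_ne_zero_of_bundles {D : DobrushinDomain} {ρ r : ℝ}
    {Λ : ℝ → Finset HexVertex} {m mr : ℝ → ℤ} {e b : ℝ → Sym2 HexVertex} {x : ℂ}
    (hA : ∀ᶠ δ : ℝ in 𝓝[>] 0, hexDomainSimplyConnected (Λ δ) ∧ b δ ∈ hexDomainBoundary (Λ δ) ∧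
      (hexGraph.induce ((Λ δ : Finset HexVertex) : Set HexVertex)).Preconnected ∧
      (∀ v ∈ Λ δ, (δ : ℂ) * hexCenter v ∈ D.carrier) ∧
      (∀ v : HexVertex, (δ : ℂ) * hexCenter v ∈ Metric.ball (D.pt 1) ρ → (v ∈ Λ δ ↔ m δ ≤ v.1 1)))
    (hP : ∀ᶠ δ : ℝ in 𝓝[>] 0, e δ ∈ hexDomainBoundary (Λ δ) ∧
      Nonempty (HexMidEdgeSAW (Λ δ) (e δ) (b δ)) ∧
      (∀ v : HexVertex, (δ : ℂ) * hexCenter v ∈ Metric.ball x r → (v ∈ Λ δ ↔ mr δ ≤ v.1 1))) :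
    ∀ᶠ δ : ℝ in 𝓝[>] 0,
      hexParafermionicObservable (Λ δ) (e δ) hexCriticalFugacity (5 / 8) (b δ) ≠ 0 ∧
      ‖hexParafermionicObservable (Λ δ) (e δ) hexCriticalFugacity (5 / 8) (b δ)‖ =
        ‖hexParafermionicObservable (Λ δ) (e δ) hexCriticalFugacity 0 (b δ)‖ :=
  eventually_normaliser_ne_zero (hA.mono fun _ h => ⟨h.1, h.2.1⟩)
    (hP.mono fun _ h => ⟨h.1, h.2.1⟩) hexCriticalFugacity_pos_lt_one.1 (5 / 8)

/-! ### The `L¹` functional of the stub: finiteness, sign, domination by the masses -/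

/-- The `L¹` functional of the norms over a finite index set is non-negative. -/
theorem l1Functional_nonneg (S : Set (Sym2 HexVertex)) (g : Sym2 HexVertex → ℂ) :
    0 ≤ ∑ᶠ z ∈ S, ‖g z‖ :=
  finsum_nonneg fun z => finsum_nonneg fun _ => norm_nonneg (g z)

/-- **Domination by the masses.** Over any finite index set, the `L¹` functional of the spin-`σ`
observable is at most that of the spin-`0` observable (the two-point masses):
`Σ ‖F_{x,σ}‖ ≤ Σ ‖F_{x,0}‖`. This is all that positivity gives; with the route's `MassRatio`
(`δ² Σ_K Z_δ ≤ C δ^{-3/4} Z_δ(b_δ)`) it yields the stub's inequality with the LOSS `δ^{-3/4}`,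
whereas the stub asks for no loss. -/
theorem l1Functional_le_massFunctional {S : Set (Sym2 HexVertex)} (hS : S.Finite)
    (Λ : Finset HexVertex) (a : Sym2 HexVertex) {x : ℝ} (hx : 0 ≤ x) (σ : ℝ) :
    ∑ᶠ z ∈ S, ‖hexParafermionicObservable Λ a x σ z‖ ≤
      ∑ᶠ z ∈ S, ‖hexParafermionicObservable Λ a x 0 z‖ := by
  rw [finsum_mem_eq_finite_toFinset_sum _ hS, finsum_mem_eq_finite_toFinset_sum _ hS]
  exact Finset.sum_le_sum fun z _ => ConjugateClassNegligibleSynthesis.norm_obs_le_norm_obs_zero Λ a hx σ z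

/-- **What positivity alone gives towards the stub** (the exact gap statement, pointwise in `δ`):
if the masses over the index set are bounded by `M · Z(b)` (`M ≥ 0`; for the route's `MassRatio`,
`M = C δ^{-3/4}`), `Λ` is simply connected and `a, b` are boundary mid-edges, then the `L¹`
functional of the spin-`σ` observable is bounded by `M · ‖F_{x,σ}(b)‖`. -/
theorem l1Functional_le_of_mass_le {S : Set (Sym2 HexVertex)} (hS : S.Finite)
    {Λ : Finset HexVertex} (hΛ : hexDomainSimplyConnected Λ) {a b : Sym2 HexVertex}
    (ha : a ∈ hexDomainBoundary Λ) (hb : b ∈ hexDomainBoundary Λ) {x : ℝ} (hx : 0 ≤ x) (σ : ℝ)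
    {c M : ℝ} (hc : 0 ≤ c)
    (hmass : c * ∑ᶠ z ∈ S, ‖hexParafermionicObservable Λ a x 0 z‖ ≤
      M * ‖hexParafermionicObservable Λ a x 0 b‖) :
    c * ∑ᶠ z ∈ S, ‖hexParafermionicObservable Λ a x σ z‖ ≤
      M * ‖hexParafermionicObservable Λ a x σ b‖ := by
  rw [norm_observable_eq_norm_zero_spin_of_mem_boundary hΛ ha hb x σ]
  exact (mul_le_mul_of_nonneg_left (l1Functional_le_massFunctional hS Λ a hx σ) hc).trans hmass

/-- **Registered sub-goal `stub_localL1Bound_normaliser`** (crux item stmt-CriticalPhenomena-14004,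
lines `pick-half-plane` / `dressed-arrival-cauchy-transform`, stub `stub_localL1Bound`): the
normaliser of the local `L¹` law is non-degenerate — for a simply connected domain, boundary
mid-edges `a, b` joined by a walk, `x > 0` and any spin `σ`, `F_{x,σ}(b) ≠ 0` and
`‖F_{x,σ}(b)‖ = Σ_{γ : a → b} x^{ℓ(γ)} = Z(b)` (winding rigidity). -/
theorem stub_localL1Bound_normaliser : ∀ (Λ : Finset HexVertex), hexDomainSimplyConnected Λ → ∀ (a b : Sym2 HexVertex), a ∈ hexDomainBoundary Λ → b ∈ hexDomainBoundary Λ → Nonempty (HexMidEdgeSAW Λ a b) → ∀ (x σ : ℝ), 0 < x → hexParafermionicObservable Λ a x σ b ≠ 0 ∧ ‖hexParafermionicObservable Λ a x σ b‖ = ∑ γ : HexMidEdgeSAW Λ a b, x ^ γ.length :=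
  fun _ hΛ _ _ ha hb hne _ σ hx =>
    ⟨observable_ne_zero_of_mem_boundary hΛ ha hb hne hx σ,
      norm_observable_eq_mass_of_mem_boundary hΛ ha hb hx.le σ⟩

end Summit.CriticalPhenomena.SAWScalingLimit.Theorems.PickHalfPlane.LocalL1

end
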